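import Mathlib
import Literature.MathematicalPhysics.QuantumFieldTheory.Balaban1983to89.B12LinearizAnalytic267

/-!
# `Balaban1983to89.B11Rem287U0Analytic` — T. Bałaban, *The variational problem and background fields in renormalization group method
# for lattice gauge theories*, Commun. Math. Phys. **102** (1985) 277–309 [Balaban1985Variational], the SECOND REMARK OF p. 287
# (SKELETON row **B11.Rem@287**): *«D(A′) … is an analytic function of U₀, because the averaging operations Q_j(U₀, ηA) and the operator
# H(U₀) are analytic in U₀ … so D(A′) has the same analyticity domain as H(U₀)»* — PROVED at the level of the Sect. C contraction scheme
# (`B13Contraction113` / `B12Lineariz267` / `B12LinearizAnalytic267`): the unique fixed point of a family of the contractions (49)–(50)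
# whose data `C_j(U₀, ·)`, `H(U₀)` depend analytically on a parameter `U₀` is (jointly) analytic in `(U₀, A′)`, on the parameter domain of
# the data

statement-level skeleton of published theorems with citation tags; proofs where landed; nothing here is a claim about the Yang–Mills mass gap

PDF held: `paper:balaban1985-cmp102-variational-background` (journal page = PDF page + 276); p. 287 [PDF 11] read by this seat from the
`lit read` text layer (2026-08-21), displays (49)–(55) pp. 285–286 as transcribed in `B13Contraction113` / `B11Eq63FunctionalDerivative`.

CITATION HEADER (lean-in-tree rule 2026-08-18).  WHAT IS REPRODUCED: SKELETON row **B11.Rem@287** (reader r08 `ROWS-B11.md`; so far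
`typed-existing (carrier, by-reference claim)`, decl of record the Sect. G carrier field `B11.AnData.HAnalytic`), i.e. the paragraph of
p. 287 [PDF 11], verbatim: *«A second remark concerns regularity properties of D(A′). We know that it is an analytic function of A′ for 𝔤ᶜ
valued configurations A′ satisfying |A′|₍₋₁₎ < ε₃. It is a function of the configuration U₀ also, and it is easy to see that it is an
analytic function of U₀, because the averaging operations Q_j(U₀, ηA) and the operator H(U₀) are analytic in U₀. The analyticity domain is
smaller for H(U₀) and was described in [5], so D(A′) has the same analyticity domain as H(U₀).»*  Context (pp. 285–286): D(A′) is the unique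
solution of the fixed-point problem (49)–(50) `X = C_j(L^jηA′ − L^jηHX)` in the ball `|X| ≦ 4C₂ε₃²` for `L^jη|A′| < ε₃`, obtained by the
contraction (53)–(54) under `9C₂B₀ε₃ < 1` — in the tree: `B13Contraction113.exists_unique_fixedPoint` (the scheme), `B12Lineariz267.exists_Dt`
(the selector «D̃»), `B12LinearizAnalytic267.analyticOnNhd_Dt` («an analytic function of A′», Fréchet sense, by the analytic implicit function
theorem).  [5] = T. Bałaban, *Propagators for lattice gauge theories in a background field*, CMP **99** (1985) 389–434
[Balaban1985BackgroundPropagators] (Sect. E there: the analyticity domain of `H(U₀)` in `U₀`).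

WHAT IS CERTIFIED (kernel, sorry-free; axioms `propext` / `Classical.choice` / `Quot.sound`).  THE PARAMETRIC SCHEME: complex Banach spaces
`𝒰` ∋ U₀ (the parameter: print's complexified background configurations, an open subset `𝒪` of a finite-dimensional complex space on the
finite lattice), `𝒴` ∋ A′, `𝒳` ∋ X; DATA `C : 𝒰 → 𝒴 → 𝒳` (print's `U₀ ↦ (Y ↦ C_j(U₀, Y))`, the nonlinear part (44) of the averaging
operation `Q_j(U₀, ηA)`) and `H : 𝒰 → (𝒳 →L[ℂ] 𝒴)` (print's `U₀ ↦ H(U₀)`); LETTERS: `C` JOINTLY ANALYTIC on `𝒪 ×ˢ {‖Y‖ < R}` and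
quadratically bounded there uniformly in `U₀` (`‖C(U₀, Y)‖ ≤ C₂‖Y‖²`, (44)), `H` ANALYTIC on `𝒪` with `‖H(U₀)‖ ≤ B₀` ((46)), the
contraction regime `9C₂B₀ε < 1`, `3ε ≤ R` of `B13Contraction113`; `D : 𝒰 → 𝒴 → 𝒳` HYPOTHESIS-STYLE — ANY selector of fixed points
(`C(U₀, A′ − H(U₀)D(U₀, A′)) = D(U₀, A′)`, `‖D(U₀, A′)‖ ≤ 4C₂ε²` for `U₀ ∈ 𝒪`, `‖A′‖ < ε`; one exists: `exists_D`).
* §1 dictionary to the one-background files: `quadAnalytic_section` (each section `C(U₀, ·)` is a `B13Contraction113.QuadAnalytic` datum —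
  its line analyticity DERIVED from the joint analyticity), `analyticOnNhd_section`, `hHop_of_opNorm`; `exists_D`, `D_unique`.
* §2 **`norm_D_sub_D_le`** — the fixed points of two members of the family differ by at most `(1 − 9C₂B₀ε)⁻¹×` the difference of the two
  contraction maps at one of them ([folklore] stability of contracting fixed points; the Lipschitz letter is (54), `B13Contraction113.lipschitz_T`);
  hence **`continuousAt_D`**: `(U₀, A′) ↦ D(U₀, A′)` is jointly continuous at every point of `𝒪 ×ˢ {‖A′‖ < ε}`.
* §3 the implicit equation `F((U₀, A′), X) = X − C(U₀, A′ − H(U₀)X)` on `(𝒰 × 𝒴) × 𝒳`: `contDiffAt_fixEq` (it is `C^ω`, i.e. analytic, at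
  every point with `U₀ ∈ 𝒪`, `‖A′ − H(U₀)X‖ < R` — THIS is print's «because the averaging operations Q_j(U₀, ηA) and the operator H(U₀) are
  analytic in U₀»: composition of the two analytic data), `fderiv_fixEq_comp_inr` (its partial derivative in `X` is `I + D_YC(U₀, Y₀)∘H(U₀)`,
  the operator `I + ℜ` of (68)–(70)), invertible by `B12LinearizAnalytic267.isInvertible_id_add_fderiv_comp_hop` ((69): `‖ℜ‖ ≤ 9C₂B₀ε < 1`).
* §4 **`analyticAt_D`** — `(U₀, A′) ↦ D(U₀, A′)` is ANALYTIC (Mathlib `AnalyticAt ℂ` on `𝒰 × 𝒴`, Fréchet sense) at every `(U₀, A′)` with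
  `U₀ ∈ 𝒪`, `‖A′‖ < ε` (complex-analytic implicit function theorem, Mathlib `ContDiffAt.implicitFunction` at `n = ω`, identified with `D`
  near the point through §2 — the pattern of `B12LinearizAnalytic267.analyticAt_and_hasStrictFDerivAt_Dt`); **`analyticOnNhd_D`** (on
  `𝒪 ×ˢ ball 0 ε`); the two sections **`analyticAt_D_background`** / **`analyticOnNhd_D_background`** («an analytic function of U₀» — for
  each fixed `A′`, on the whole parameter domain `𝒪` of the data: «D(A′) has the same analyticity domain as H(U₀)») and `analyticOnNhd_D_field`
  («an analytic function of A′», recovering `B12LinearizAnalytic267.analyticOnNhd_Dt` per background); **`analyticOnNhd_D_background_of_subdomain`**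
  — the printed shape with TWO domains: `Q_j` analytic on `𝒪_Q`, `H` on the smaller `𝒪_H ⊆ 𝒪_Q` ⟹ `D(·, A′)` analytic on `𝒪_H`.

MODEL / DECLARED READINGS.  (M1) «analytic in U₀»: U₀ ranges over (complexified) group-valued lattice configurations; on the finite lattice
this is an open subset of a finite-dimensional complex vector space, and «analytic» = holomorphic there = Mathlib `AnalyticAt ℂ` on an open
set `𝒪 ⊆ 𝒰` of a complex Banach space (the chart is the user's; cf. `B11.AnData`, `B12LocEAnalytic`).  (M2) The two printed REASONS are the
two analyticity LETTERS `hCa` (for `Q_j(U₀, ηA)`, through its nonlinear part `C_j(U₀, ·)`: the linear part `L^jηQ_j` does not enter (49)) and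
`hHa` (for `H(U₀)`, as an operator-valued analytic map); the uniformity of the constants `C₂` ((44), [4] Prop. 4) and `B₀` ((46), [5]
Thm 3.12) over the domain is print's (they are absolute constants).  (M3) «the same analyticity domain as H(U₀)»: typed as the conclusion on
the whole parameter domain `𝒪` on which BOTH letters hold — print: dom H ⊆ dom Q, so `𝒪 = dom H` (`analyticOnNhd_D_background_of_subdomain`).
(M4) Completeness of `𝒰`, `𝒴`, `𝒳` (Mathlib's implicit function theorem is stated over Banach spaces) is automatic on the finite lattice.

HONEST SCOPE — what is NOT claimed.  The letters themselves — analyticity of `U₀ ↦ C_j(U₀, ·)` ([4] Sect. 5) and of `U₀ ↦ H(U₀)` with its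
domain ([5] Sect. E) — are hypotheses here, exactly as print invokes them; no lattice object is constructed (the concrete `C_j` on ℤᵈ is
`B11Eq44Concrete.Cmap` at a FIXED background; its U₀-analyticity is not in the tree).  No new named fact (`Prop` placeholder): every
declaration is a theorem over hypothesis binders.  Mega-formalization `lit-balaban`, HOME `run/shared/lean/pub/lit-balaban/`, reader/typer
seat r08 gen 9 (unit `lit-balaban-r08`, B11 fold owner).  Imports `B12LinearizAnalytic267` (hence `B12Lineariz267`, `B13Contraction113`);
modifies nothing there.
-/

namespace Literature.MathematicalPhysics.QuantumFieldTheory.Balaban1983to89.B11Rem287U0Analytic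

open Metric Set Filter Topology
open scoped ContDiff
open Literature.MathematicalPhysics.QuantumFieldTheory.Balaban1983to89
open B13Contraction113 B12Lineariz267 B12LinearizAnalytic267

variable {𝒰 𝒳 𝒴 : Type*} [NormedAddCommGroup 𝒰] [NormedSpace ℂ 𝒰]
  [NormedAddCommGroup 𝒳] [NormedSpace ℂ 𝒳] [NormedAddCommGroup 𝒴] [NormedSpace ℂ 𝒴]
  {𝒪 : Set 𝒰} {C : 𝒰 → 𝒴 → 𝒳} {H : 𝒰 → (𝒳 →L[ℂ] 𝒴)} {C₂ R B₀ ε : ℝ} {D : 𝒰 → 𝒴 → 𝒳}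

/-! ## §1 Dictionary: each background `U₀ ∈ 𝒪` gives one datum of the Sect. C scheme -/

omit [NormedAddCommGroup 𝒰] [NormedSpace ℂ 𝒰] in
/-- The bound letter of `H(U₀)` in the form consumed by `B13Contraction113` / `B12Lineariz267` (`‖H X‖ ≤ B₀‖X‖`, (46) p. 285 read as an
operator norm bound). [cite: Balaban1985Variational, (46) p.285] -/
theorem hHop_of_opNorm {u : 𝒰} (hB : ‖H u‖ ≤ B₀) : ∀ X : 𝒳, ‖(H u : 𝒳 →ₗ[ℂ] 𝒴) X‖ ≤ B₀ * ‖X‖ :=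
  fun X => (H u).le_of_opNorm_le hB X

omit [NormedAddCommGroup 𝒰] [NormedSpace ℂ 𝒰] in
/-- The linear-map coercion of `H(U₀)` made continuous again with the bound `B₀` IS `H(U₀)` (bookkeeping between the `→ₗ` letters of
`B12Lineariz267` and the `→L` datum here). [folklore] -/
private theorem mkContinuous_coe {u : 𝒰} (hB : ‖H u‖ ≤ B₀) :
    (H u : 𝒳 →ₗ[ℂ] 𝒴).mkContinuous B₀ (hHop_of_opNorm hB) = H u := by
  ext X; rfl

/-- A section `Y ↦ C(U₀, Y)` of a jointly analytic `C` is analytic («Q_j(U₀, ηA) … analytic» ⟹ `C_j(U₀, ·)` analytic in the field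
variable, the letter of `B12LinearizAnalytic267`). [cite: Balaban1985Variational, p.287] -/
theorem analyticAt_section {u : 𝒰} {Y : 𝒴} (h : AnalyticAt ℂ (fun p : 𝒰 × 𝒴 => C p.1 p.2) (u, Y)) :
    AnalyticAt ℂ (C u) Y := by
  have h2 : AnalyticAt ℂ (fun Y' : 𝒴 => (u, Y')) Y := analyticAt_const.prod analyticAt_id
  have h3 := AnalyticAt.comp_of_eq h h2 rfl
  simpa [Function.comp_def] using h3

/-- The section `C(U₀, ·)` is analytic on the ball `‖Y‖ < R` for every `U₀ ∈ 𝒪` («an analytic function of A′» for the datum at each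
background). [cite: Balaban1985Variational, p.287] -/
theorem analyticOnNhd_section (hCa : AnalyticOnNhd ℂ (fun p : 𝒰 × 𝒴 => C p.1 p.2) (𝒪 ×ˢ {Y : 𝒴 | ‖Y‖ < R}))
    {u : 𝒰} (hu : u ∈ 𝒪) : AnalyticOnNhd ℂ (C u) {Y : 𝒴 | ‖Y‖ < R} :=
  fun Y hY => analyticAt_section (hCa (u, Y) ⟨hu, hY⟩)

/-- **Each background gives a `QuadAnalytic` datum** of `B13Contraction113` (the quadratic bound (44) + analyticity along complex lines,
the latter DERIVED from the joint analyticity letter). [cite: Balaban1985Variational, (44) p.285, p.287] -/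
theorem quadAnalytic_section (hCa : AnalyticOnNhd ℂ (fun p : 𝒰 × 𝒴 => C p.1 p.2) (𝒪 ×ˢ {Y : 𝒴 | ‖Y‖ < R}))
    (hquad : ∀ u ∈ 𝒪, ∀ Y : 𝒴, ‖Y‖ < R → ‖C u Y‖ ≤ C₂ * ‖Y‖ ^ 2) {u : 𝒰} (hu : u ∈ 𝒪) :
    QuadAnalytic (C u) C₂ R where
  quad := hquad u hu
  lineAnalytic P Q := by
    have hd : DifferentiableOn ℂ (C u) {Y : 𝒴 | ‖Y‖ < R} := (analyticOnNhd_section hCa hu).differentiableOn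
    have hl : Differentiable ℂ (fun ζ : ℂ => P + ζ • Q) := by fun_prop
    exact hd.comp hl.differentiableOn fun ζ hζ => hζ

variable [CompleteSpace 𝒳]

/-- **Existence of the family of fixed points** («for arbitrary A′ … there exists exactly one fixed point», p. 286, for EVERY background
in the domain of the data): a selector `D(U₀, A′)` with `‖D(U₀, A′)‖ ≤ 4C₂ε²` solving `C(U₀, A′ − H(U₀)D(U₀, A′)) = D(U₀, A′)` for `U₀ ∈ 𝒪`,
`‖A′‖ < ε` (`B12Lineariz267.exists_Dt` background by background). [cite: Balaban1985Variational, (49)-(55) pp.285-286, p.287] -/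
theorem exists_D (hCa : AnalyticOnNhd ℂ (fun p : 𝒰 × 𝒴 => C p.1 p.2) (𝒪 ×ˢ {Y : 𝒴 | ‖Y‖ < R}))
    (hquad : ∀ u ∈ 𝒪, ∀ Y : 𝒴, ‖Y‖ < R → ‖C u Y‖ ≤ C₂ * ‖Y‖ ^ 2) (hHB : ∀ u ∈ 𝒪, ‖H u‖ ≤ B₀)
    (hC₂ : 0 ≤ C₂) (hB₀ : 0 ≤ B₀) (hq : 9 * C₂ * B₀ * ε < 1) (hRC : 3 * ε ≤ R) :
    ∃ D : 𝒰 → 𝒴 → 𝒳, ∀ u ∈ 𝒪, ∀ A : 𝒴, ‖A‖ < ε →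
      D u A ∈ closedBall (0 : 𝒳) (4 * C₂ * ε ^ 2) ∧ C u (A - H u (D u A)) = D u A := by
  classical
  have hex : ∀ u ∈ 𝒪, ∃ Dt : 𝒴 → 𝒳, ∀ A : 𝒴, ‖A‖ < ε →
      Dt A ∈ closedBall (0 : 𝒳) (4 * C₂ * ε ^ 2) ∧ C u (A - (H u : 𝒳 →ₗ[ℂ] 𝒴) (Dt A)) = Dt A :=
    fun u hu => exists_Dt (quadAnalytic_section hCa hquad hu) hC₂ hB₀ (hHop_of_opNorm (hHB u hu)) hq hRC
  refine ⟨fun u => if hu : u ∈ 𝒪 then Classical.choose (hex u hu) else fun _ => 0, fun u hu A hA => ?_⟩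
  simp only [dif_pos hu]
  exact Classical.choose_spec (hex u hu) A hA

/-- **«exactly one»** for the family: two selectors agree on `𝒪 ×ˢ {‖A′‖ < ε}` (`B12Lineariz267.Dt_unique` background by background).
[cite: Balaban1985Variational, p.286, p.287] -/
theorem D_unique (hCa : AnalyticOnNhd ℂ (fun p : 𝒰 × 𝒴 => C p.1 p.2) (𝒪 ×ˢ {Y : 𝒴 | ‖Y‖ < R}))
    (hquad : ∀ u ∈ 𝒪, ∀ Y : 𝒴, ‖Y‖ < R → ‖C u Y‖ ≤ C₂ * ‖Y‖ ^ 2) (hHB : ∀ u ∈ 𝒪, ‖H u‖ ≤ B₀)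
    (hC₂ : 0 ≤ C₂) (hB₀ : 0 ≤ B₀) (hq : 9 * C₂ * B₀ * ε < 1) (hRC : 3 * ε ≤ R) {D₁ D₂ : 𝒰 → 𝒴 → 𝒳}
    (h₁ball : ∀ u ∈ 𝒪, ∀ A : 𝒴, ‖A‖ < ε → D₁ u A ∈ closedBall (0 : 𝒳) (4 * C₂ * ε ^ 2))
    (h₁fix : ∀ u ∈ 𝒪, ∀ A : 𝒴, ‖A‖ < ε → C u (A - H u (D₁ u A)) = D₁ u A)
    (h₂ball : ∀ u ∈ 𝒪, ∀ A : 𝒴, ‖A‖ < ε → D₂ u A ∈ closedBall (0 : 𝒳) (4 * C₂ * ε ^ 2))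
    (h₂fix : ∀ u ∈ 𝒪, ∀ A : 𝒴, ‖A‖ < ε → C u (A - H u (D₂ u A)) = D₂ u A)
    {u : 𝒰} (hu : u ∈ 𝒪) {A : 𝒴} (hA : ‖A‖ < ε) : D₁ u A = D₂ u A :=
  Dt_unique (hop := (H u : 𝒳 →ₗ[ℂ] 𝒴)) (quadAnalytic_section hCa hquad hu) hC₂ hB₀ (hHop_of_opNorm (hHB u hu)) hq hRC
    (h₁ball u hu) (h₁fix u hu) (h₂ball u hu) (h₂fix u hu) hA

/-! ## §2 Stability of the fixed point in the background: joint continuity -/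

omit [CompleteSpace 𝒳] in
/-- **Stability of contracting fixed points** ([folklore]): for two members `(U₀, A′)`, `(U₀′, A′₀)` of the family,
`(1 − 9C₂B₀ε)·‖D(U₀, A′) − D(U₀′, A′₀)‖ ≤ ‖C(U₀, A′ − H(U₀)X₀) − C(U₀′, A′₀ − H(U₀′)X₀)‖`, `X₀ = D(U₀′, A′₀)` — the two contraction maps
compared at the second fixed point; the Lipschitz constant `9C₂B₀ε` is (54). [cite: Balaban1985Variational, (54) p.286, p.287] -/
theorem norm_D_sub_D_le (hCa : AnalyticOnNhd ℂ (fun p : 𝒰 × 𝒴 => C p.1 p.2) (𝒪 ×ˢ {Y : 𝒴 | ‖Y‖ < R}))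
    (hquad : ∀ u ∈ 𝒪, ∀ Y : 𝒴, ‖Y‖ < R → ‖C u Y‖ ≤ C₂ * ‖Y‖ ^ 2) (hHB : ∀ u ∈ 𝒪, ‖H u‖ ≤ B₀)
    (hC₂ : 0 ≤ C₂) (hB₀ : 0 ≤ B₀) (hq : 9 * C₂ * B₀ * ε < 1) (hRC : 3 * ε ≤ R)
    (hDball : ∀ u ∈ 𝒪, ∀ A : 𝒴, ‖A‖ < ε → D u A ∈ closedBall (0 : 𝒳) (4 * C₂ * ε ^ 2))
    (hDfix : ∀ u ∈ 𝒪, ∀ A : 𝒴, ‖A‖ < ε → C u (A - H u (D u A)) = D u A)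
    {u u₀ : 𝒰} (hu : u ∈ 𝒪) (hu₀ : u₀ ∈ 𝒪) {A A₀ : 𝒴} (hA : ‖A‖ < ε) (hA₀ : ‖A₀‖ < ε) :
    (1 - 9 * C₂ * B₀ * ε) * ‖D u A - D u₀ A₀‖ ≤
      ‖C u (A - H u (D u₀ A₀)) - C u₀ (A₀ - H u₀ (D u₀ A₀))‖ := by
  have hε : 0 < ε := (norm_nonneg _).trans_lt hA
  have h9 : 0 ≤ 9 * C₂ * B₀ := by positivity
  have hR2 : 4 * C₂ * B₀ * ε ≤ 1 := by nlinarith [mul_nonneg h9 hε.le]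
  have hX : D u A ∈ closedBall (0 : 𝒳) (4 * C₂ * ε ^ 2) := hDball u hu A hA
  have hX₀ : D u₀ A₀ ∈ closedBall (0 : 𝒳) (4 * C₂ * ε ^ 2) := hDball u₀ hu₀ A₀ hA₀
  have hlip : ‖C u (A - H u (D u A)) - C u (A - H u (D u₀ A₀))‖ ≤ 9 * C₂ * B₀ * ε * ‖D u A - D u₀ A₀‖ :=
    lipschitz_T (Hop := (H u : 𝒳 →ₗ[ℂ] 𝒴)) (A' := A) (quadAnalytic_section hCa hquad hu) hC₂ hB₀
      (hHop_of_opNorm (hHB u hu)) hA hR2 hRC hX hX₀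
  have hsplit : D u A - D u₀ A₀ = (C u (A - H u (D u A)) - C u (A - H u (D u₀ A₀))) +
      (C u (A - H u (D u₀ A₀)) - C u₀ (A₀ - H u₀ (D u₀ A₀))) := by
    rw [hDfix u hu A hA, hDfix u₀ hu₀ A₀ hA₀]; abel
  have hle : ‖D u A - D u₀ A₀‖ ≤ 9 * C₂ * B₀ * ε * ‖D u A - D u₀ A₀‖ +
      ‖C u (A - H u (D u₀ A₀)) - C u₀ (A₀ - H u₀ (D u₀ A₀))‖ := by
    calc ‖D u A - D u₀ A₀‖
        = ‖(C u (A - H u (D u A)) - C u (A - H u (D u₀ A₀))) +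
            (C u (A - H u (D u₀ A₀)) - C u₀ (A₀ - H u₀ (D u₀ A₀)))‖ := by rw [← hsplit]
      _ ≤ ‖C u (A - H u (D u A)) - C u (A - H u (D u₀ A₀))‖ +
            ‖C u (A - H u (D u₀ A₀)) - C u₀ (A₀ - H u₀ (D u₀ A₀))‖ := norm_add_le _ _
      _ ≤ _ := by gcongr
  linarith

omit [CompleteSpace 𝒳] in
/-- The comparison map `(U₀, A′) ↦ C(U₀, A′ − H(U₀)X₀)` is continuous at `(U₀′, A′₀)` when `‖A′₀ − H(U₀′)X₀‖ < R` («because …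
Q_j(U₀, ηA) and … H(U₀) are analytic in U₀» — here only their continuity is used). [cite: Balaban1985Variational, p.287] -/
theorem continuousAt_compare (hCa : AnalyticOnNhd ℂ (fun p : 𝒰 × 𝒴 => C p.1 p.2) (𝒪 ×ˢ {Y : 𝒴 | ‖Y‖ < R}))
    (hHa : AnalyticOnNhd ℂ H 𝒪) {u₀ : 𝒰} (hu₀ : u₀ ∈ 𝒪) {A₀ : 𝒴} (X₀ : 𝒳) (hY₀ : ‖A₀ - H u₀ X₀‖ < R) :
    ContinuousAt (fun p : 𝒰 × 𝒴 => C p.1 (p.2 - H p.1 X₀)) (u₀, A₀) := by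
  have hG : ContinuousAt (fun p : 𝒰 × 𝒴 => (p.1, p.2 - H p.1 X₀)) (u₀, A₀) := by
    have hH : ContinuousAt (fun p : 𝒰 × 𝒴 => H p.1 X₀) (u₀, A₀) :=
      ((hHa u₀ hu₀).continuousAt.comp continuousAt_fst).clm_apply continuousAt_const
    exact continuousAt_fst.prodMk (continuousAt_snd.sub hH)
  have hC : ContinuousAt (fun p : 𝒰 × 𝒴 => C p.1 p.2) (u₀, A₀ - H u₀ X₀) :=
    (hCa (u₀, A₀ - H u₀ X₀) ⟨hu₀, hY₀⟩).continuousAt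
  exact ContinuousAt.comp_of_eq (g := fun p : 𝒰 × 𝒴 => C p.1 p.2) hC hG rfl

/-- **Joint continuity of `(U₀, A′) ↦ D(U₀, A′)`** at every `U₀ ∈ 𝒪` (open), `‖A′‖ < ε`: from `norm_D_sub_D_le` and the continuity of the
comparison map (`Y₀ = A′₀ − H(U₀′)D(U₀′, A′₀)` has `‖Y₀‖ < 2ε < R`, `B12Lineariz267.mapsTo_phi`) — the continuity half of «an analytic
function of U₀ [and] of A′». [cite: Balaban1985Variational, p.287] -/
theorem continuousAt_D (h𝒪 : IsOpen 𝒪) (hCa : AnalyticOnNhd ℂ (fun p : 𝒰 × 𝒴 => C p.1 p.2) (𝒪 ×ˢ {Y : 𝒴 | ‖Y‖ < R}))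
    (hquad : ∀ u ∈ 𝒪, ∀ Y : 𝒴, ‖Y‖ < R → ‖C u Y‖ ≤ C₂ * ‖Y‖ ^ 2) (hHa : AnalyticOnNhd ℂ H 𝒪)
    (hHB : ∀ u ∈ 𝒪, ‖H u‖ ≤ B₀) (hC₂ : 0 ≤ C₂) (hB₀ : 0 ≤ B₀) (hq : 9 * C₂ * B₀ * ε < 1) (hRC : 3 * ε ≤ R)
    (hDball : ∀ u ∈ 𝒪, ∀ A : 𝒴, ‖A‖ < ε → D u A ∈ closedBall (0 : 𝒳) (4 * C₂ * ε ^ 2))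
    (hDfix : ∀ u ∈ 𝒪, ∀ A : 𝒴, ‖A‖ < ε → C u (A - H u (D u A)) = D u A)
    {u₀ : 𝒰} (hu₀ : u₀ ∈ 𝒪) {A₀ : 𝒴} (hA₀ : ‖A₀‖ < ε) :
    ContinuousAt (fun p : 𝒰 × 𝒴 => D p.1 p.2) (u₀, A₀) := by
  have hε : 0 < ε := (norm_nonneg _).trans_lt hA₀
  have h1q : 0 < 1 - 9 * C₂ * B₀ * ε := sub_pos.mpr hq
  have hY₀ : ‖A₀ - H u₀ (D u₀ A₀)‖ < 2 * ε :=
    mem_ball_zero_iff.mp (mapsTo_phi (hop := (H u₀ : 𝒳 →ₗ[ℂ] 𝒴)) (Dt := D u₀)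
      (quadAnalytic_section hCa hquad hu₀) hC₂ hB₀ (hHop_of_opNorm (hHB u₀ hu₀)) hq hRC (hDball u₀ hu₀) (hDfix u₀ hu₀)
      (mem_ball_zero_iff.mpr hA₀))
  have hY₀R : ‖A₀ - H u₀ (D u₀ A₀)‖ < R := by linarith
  have hcmp := continuousAt_compare hCa hHa hu₀ (D u₀ A₀) hY₀R
  rw [Metric.continuousAt_iff] at hcmp ⊢
  intro η hη
  obtain ⟨δ₁, hδ₁, hδ₁'⟩ := hcmp ((1 - 9 * C₂ * B₀ * ε) * η) (by positivity)
  -- a neighbourhood inside `𝒪 ×ˢ ball 0 ε`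
  obtain ⟨δ₂, hδ₂, hδ₂'⟩ := Metric.isOpen_iff.mp h𝒪 u₀ hu₀
  refine ⟨min δ₁ (min δ₂ (ε - ‖A₀‖)), lt_min hδ₁ (lt_min hδ₂ (by linarith)), fun p hp => ?_⟩
  have hp₁ : dist p (u₀, A₀) < δ₁ := lt_of_lt_of_le hp (min_le_left _ _)
  have hp₂ : dist p (u₀, A₀) < δ₂ := lt_of_lt_of_le hp ((min_le_right _ _).trans (min_le_left _ _))
  have hp₃ : dist p (u₀, A₀) < ε - ‖A₀‖ := lt_of_lt_of_le hp ((min_le_right _ _).trans (min_le_right _ _))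
  have hfst : dist p.1 u₀ ≤ dist p (u₀, A₀) := by rw [Prod.dist_eq]; exact le_max_left _ _
  have hsnd : dist p.2 A₀ ≤ dist p (u₀, A₀) := by rw [Prod.dist_eq]; exact le_max_right _ _
  have hu : p.1 ∈ 𝒪 := hδ₂' (lt_of_le_of_lt hfst hp₂)
  have hA : ‖p.2‖ < ε := by
    have h2 : dist p.2 A₀ < ε - ‖A₀‖ := lt_of_le_of_lt hsnd hp₃
    rw [dist_eq_norm] at h2
    calc ‖p.2‖ = ‖(p.2 - A₀) + A₀‖ := by rw [sub_add_cancel]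
      _ ≤ ‖p.2 - A₀‖ + ‖A₀‖ := norm_add_le _ _
      _ < ε := by linarith
  have hkey := norm_D_sub_D_le hCa hquad hHB hC₂ hB₀ hq hRC hDball hDfix hu hu₀ hA hA₀
  have hd := hδ₁' hp₁
  rw [dist_eq_norm] at hd
  simp only at hd
  rw [dist_eq_norm]
  show ‖D p.1 p.2 - D u₀ A₀‖ < η
  by_contra hcon
  have hcon' : η ≤ ‖D p.1 p.2 - D u₀ A₀‖ := not_lt.mp hcon
  have : (1 - 9 * C₂ * B₀ * ε) * η ≤ (1 - 9 * C₂ * B₀ * ε) * ‖D p.1 p.2 - D u₀ A₀‖ :=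
    mul_le_mul_of_nonneg_left hcon' h1q.le
  have htri : ‖C p.1 (p.2 - H p.1 (D u₀ A₀)) - C u₀ (A₀ - H u₀ (D u₀ A₀))‖ < (1 - 9 * C₂ * B₀ * ε) * η := hd
  linarith

/-! ## §3 The implicit equation `F((U₀, A′), X) = X − C(U₀, A′ − H(U₀)X)` -/

omit [CompleteSpace 𝒳] in
/-- The inner map `((U₀, A′), X) ↦ (U₀, A′ − H(U₀)X)` is `C^ω` wherever `H` is analytic at `U₀` (the letter «H(U₀) … analytic in U₀»).
[cite: Balaban1985Variational, p.287] -/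
theorem contDiffAt_inner [CompleteSpace 𝒴] (hHa : AnalyticOnNhd ℂ H 𝒪) {u : 𝒰} (hu : u ∈ 𝒪) (A : 𝒴) (X : 𝒳) :
    ContDiffAt ℂ ω (fun p : (𝒰 × 𝒴) × 𝒳 => (p.1.1, p.1.2 - H p.1.1 p.2)) ((u, A), X) := by
  have h1 : ContDiffAt ℂ ω (fun p : (𝒰 × 𝒴) × 𝒳 => p.1.1) ((u, A), X) := contDiffAt_fst.comp _ contDiffAt_fst
  have h2 : ContDiffAt ℂ ω (fun p : (𝒰 × 𝒴) × 𝒳 => p.1.2) ((u, A), X) := contDiffAt_snd.comp _ contDiffAt_fst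
  have hH : ContDiffAt ℂ ω (fun p : (𝒰 × 𝒴) × 𝒳 => H p.1.1) ((u, A), X) :=
    ((hHa u hu).contDiffAt).comp _ h1
  exact h1.prodMk (h2.sub (hH.clm_apply contDiffAt_snd))

/-- **The implicit equation is analytic** (`C^ω`) at every `((U₀, A′), X)` with `U₀ ∈ 𝒪`, `‖A′ − H(U₀)X‖ < R` — print's «because the
averaging operations Q_j(U₀, ηA) and the operator H(U₀) are analytic in U₀»: the composition of the two analytic letters.
[cite: Balaban1985Variational, p.287] -/
theorem contDiffAt_fixEq [CompleteSpace 𝒴] (hCa : AnalyticOnNhd ℂ (fun p : 𝒰 × 𝒴 => C p.1 p.2) (𝒪 ×ˢ {Y : 𝒴 | ‖Y‖ < R}))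
    (hHa : AnalyticOnNhd ℂ H 𝒪) {u : 𝒰} (hu : u ∈ 𝒪) (A : 𝒴) (X : 𝒳) (hp : ‖A - H u X‖ < R) :
    ContDiffAt ℂ ω (fun p : (𝒰 × 𝒴) × 𝒳 => p.2 - C p.1.1 (p.1.2 - H p.1.1 p.2)) ((u, A), X) := by
  have hin := contDiffAt_inner hHa hu A X
  have hC : ContDiffAt ℂ ω (fun p : 𝒰 × 𝒴 => C p.1 p.2)
      ((fun p : (𝒰 × 𝒴) × 𝒳 => (p.1.1, p.1.2 - H p.1.1 p.2)) ((u, A), X)) :=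
    (hCa (u, A - H u X) ⟨hu, hp⟩).contDiffAt
  have hcomp : ContDiffAt ℂ ω ((fun p : 𝒰 × 𝒴 => C p.1 p.2) ∘ fun p : (𝒰 × 𝒴) × 𝒳 => (p.1.1, p.1.2 - H p.1.1 p.2))
      ((u, A), X) := hC.comp ((u, A), X) hin
  exact contDiffAt_snd.sub (by simpa [Function.comp_def] using hcomp)

omit [NormedAddCommGroup 𝒰] [NormedSpace ℂ 𝒰] [CompleteSpace 𝒳] in
/-- The `X`-section of the implicit equation at `((U₀, A′), ·)` has derivative `I + D_YC(U₀, Y₀)∘H(U₀)` at `X`, `Y₀ = A′ − H(U₀)X` — the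
operator `I + ℜ` of (68). [cite: Balaban1985Variational, (68) p.288] -/
theorem hasFDerivAt_fixEq_section {u : 𝒰} {A : 𝒴} {X : 𝒳} (hd : DifferentiableAt ℂ (C u) (A - H u X)) :
    HasFDerivAt (fun X' : 𝒳 => X' - C u (A - H u X'))
      (ContinuousLinearMap.id ℂ 𝒳 + fderiv ℂ (C u) (A - H u X) ∘L H u) X := by
  have haff : HasFDerivAt (fun X' : 𝒳 => A - H u X') (-(H u)) X := (H u).hasFDerivAt.const_sub A
  have hC := hd.hasFDerivAt.comp X haff
  have h := (hasFDerivAt_id X).sub hC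
  have hL : ContinuousLinearMap.id ℂ 𝒳 - fderiv ℂ (C u) (A - H u X) ∘L (-(H u)) =
      ContinuousLinearMap.id ℂ 𝒳 + fderiv ℂ (C u) (A - H u X) ∘L H u := by
    rw [ContinuousLinearMap.comp_neg, sub_neg_eq_add]
  exact h.congr_fderiv hL

/-- **The partial derivative of the implicit equation in `X` is `I + D_YC(U₀, Y₀)∘H(U₀)`** (`fderiv F ∘ inr`, by uniqueness of the
derivative of the `X`-section). [cite: Balaban1985Variational, (68) p.288] -/
theorem fderiv_fixEq_comp_inr [CompleteSpace 𝒴] (hCa : AnalyticOnNhd ℂ (fun p : 𝒰 × 𝒴 => C p.1 p.2) (𝒪 ×ˢ {Y : 𝒴 | ‖Y‖ < R}))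
    (hHa : AnalyticOnNhd ℂ H 𝒪) {u : 𝒰} (hu : u ∈ 𝒪) (A : 𝒴) (X : 𝒳) (hp : ‖A - H u X‖ < R) :
    fderiv ℂ (fun p : (𝒰 × 𝒴) × 𝒳 => p.2 - C p.1.1 (p.1.2 - H p.1.1 p.2)) ((u, A), X) ∘L
        ContinuousLinearMap.inr ℂ (𝒰 × 𝒴) 𝒳 =
      ContinuousLinearMap.id ℂ 𝒳 + fderiv ℂ (C u) (A - H u X) ∘L H u := by
  set F : (𝒰 × 𝒴) × 𝒳 → 𝒳 := fun p => p.2 - C p.1.1 (p.1.2 - H p.1.1 p.2) with hF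
  have hFd : DifferentiableAt ℂ F ((u, A), X) := (contDiffAt_fixEq hCa hHa hu A X hp).differentiableAt (by simp)
  -- the section `X' ↦ F ((u, A), X')` through `inr`
  have hsec : HasFDerivAt (fun X' : 𝒳 => F ((u, A), X'))
      (fderiv ℂ F ((u, A), X) ∘L ContinuousLinearMap.inr ℂ (𝒰 × 𝒴) 𝒳) X :=
    hFd.hasFDerivAt.comp X (hasFDerivAt_prodMk_right ((u, A) : 𝒰 × 𝒴) X)
  have hd : DifferentiableAt ℂ (C u) (A - H u X) := (analyticAt_section (hCa (u, A - H u X) ⟨hu, hp⟩)).differentiableAt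
  have hsec' : HasFDerivAt (fun X' : 𝒳 => F ((u, A), X'))
      (ContinuousLinearMap.id ℂ 𝒳 + fderiv ℂ (C u) (A - H u X) ∘L H u) X := hasFDerivAt_fixEq_section hd
  exact hsec.unique hsec'

/-- **`I + D_YC(U₀, Y₀)∘H(U₀)` is invertible at `Y₀ = A′ − H(U₀)D(U₀, A′)`**, `‖A′‖ < ε` — (69): `‖ℜ‖ ≤ 9C₂B₀ε < 1`
(`B12LinearizAnalytic267.isInvertible_id_add_fderiv_comp_hop` at the background `U₀`). [cite: Balaban1985Variational, (69) p.288] -/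
theorem isInvertible_partial (hCa : AnalyticOnNhd ℂ (fun p : 𝒰 × 𝒴 => C p.1 p.2) (𝒪 ×ˢ {Y : 𝒴 | ‖Y‖ < R}))
    (hquad : ∀ u ∈ 𝒪, ∀ Y : 𝒴, ‖Y‖ < R → ‖C u Y‖ ≤ C₂ * ‖Y‖ ^ 2) (hHB : ∀ u ∈ 𝒪, ‖H u‖ ≤ B₀)
    (hC₂ : 0 ≤ C₂) (hB₀ : 0 ≤ B₀) (hq : 9 * C₂ * B₀ * ε < 1) (hRC : 3 * ε ≤ R)
    (hDball : ∀ u ∈ 𝒪, ∀ A : 𝒴, ‖A‖ < ε → D u A ∈ closedBall (0 : 𝒳) (4 * C₂ * ε ^ 2))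
    (hDfix : ∀ u ∈ 𝒪, ∀ A : 𝒴, ‖A‖ < ε → C u (A - H u (D u A)) = D u A)
    {u : 𝒰} (hu : u ∈ 𝒪) {A : 𝒴} (hA : ‖A‖ < ε) :
    (ContinuousLinearMap.id ℂ 𝒳 + fderiv ℂ (C u) (A - H u (D u A)) ∘L H u).IsInvertible ∧
      ‖(ContinuousLinearMap.id ℂ 𝒳 + fderiv ℂ (C u) (A - H u (D u A)) ∘L H u).inverse‖ ≤ (1 - 9 * C₂ * B₀ * ε)⁻¹ := by
  have h := isInvertible_id_add_fderiv_comp_hop (hop := (H u : 𝒳 →ₗ[ℂ] 𝒴)) (Dt := D u)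
    (quadAnalytic_section hCa hquad hu) (analyticOnNhd_section hCa hu).differentiableOn hC₂ hB₀ (hHop_of_opNorm (hHB u hu)) hq hRC
    (hDball u hu) (hDfix u hu) hA
  rwa [mkContinuous_coe (hHB u hu)] at h

/-! ## §4 «an analytic function of U₀» -/

variable [CompleteSpace 𝒰] [CompleteSpace 𝒴]

/-- **JOINT ANALYTICITY OF `(U₀, A′) ↦ D(U₀, A′)`** at every `U₀ ∈ 𝒪`, `‖A′‖ < ε` — the second remark of p. 287 at scheme level: *«it is an
analytic function of U₀, because the averaging operations Q_j(U₀, ηA) and the operator H(U₀) are analytic in U₀»*.  Proof: the complex-analytic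
implicit function theorem (Mathlib `ContDiffAt.implicitFunction`, `n = ω`) for `F((U₀, A′), X) = X − C(U₀, A′ − H(U₀)X)` at
`((U₀, A′), D(U₀, A′))` (§3), and the identification of the implicit function with `D` near the point (uniqueness of the local solution +
joint continuity of `D`, §2). [cite: Balaban1985Variational, p.287] -/
theorem analyticAt_D (h𝒪 : IsOpen 𝒪) (hCa : AnalyticOnNhd ℂ (fun p : 𝒰 × 𝒴 => C p.1 p.2) (𝒪 ×ˢ {Y : 𝒴 | ‖Y‖ < R}))
    (hquad : ∀ u ∈ 𝒪, ∀ Y : 𝒴, ‖Y‖ < R → ‖C u Y‖ ≤ C₂ * ‖Y‖ ^ 2) (hHa : AnalyticOnNhd ℂ H 𝒪)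
    (hHB : ∀ u ∈ 𝒪, ‖H u‖ ≤ B₀) (hC₂ : 0 ≤ C₂) (hB₀ : 0 ≤ B₀) (hq : 9 * C₂ * B₀ * ε < 1) (hRC : 3 * ε ≤ R)
    (hDball : ∀ u ∈ 𝒪, ∀ A : 𝒴, ‖A‖ < ε → D u A ∈ closedBall (0 : 𝒳) (4 * C₂ * ε ^ 2))
    (hDfix : ∀ u ∈ 𝒪, ∀ A : 𝒴, ‖A‖ < ε → C u (A - H u (D u A)) = D u A)
    {u₀ : 𝒰} (hu₀ : u₀ ∈ 𝒪) {A₀ : 𝒴} (hA₀ : ‖A₀‖ < ε) :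
    AnalyticAt ℂ (fun p : 𝒰 × 𝒴 => D p.1 p.2) (u₀, A₀) := by
  have hε : 0 < ε := (norm_nonneg _).trans_lt hA₀
  have hω : (ω : ℕ∞ω) ≠ 0 := by simp
  have hY₀ : ‖A₀ - H u₀ (D u₀ A₀)‖ < 2 * ε :=
    mem_ball_zero_iff.mp (mapsTo_phi (hop := (H u₀ : 𝒳 →ₗ[ℂ] 𝒴)) (Dt := D u₀)
      (quadAnalytic_section hCa hquad hu₀) hC₂ hB₀ (hHop_of_opNorm (hHB u₀ hu₀)) hq hRC (hDball u₀ hu₀) (hDfix u₀ hu₀)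
      (mem_ball_zero_iff.mpr hA₀))
  have hY₀R : ‖A₀ - H u₀ (D u₀ A₀)‖ < R := by linarith
  set F : (𝒰 × 𝒴) × 𝒳 → 𝒳 := fun p => p.2 - C p.1.1 (p.1.2 - H p.1.1 p.2) with hF
  have hFω : ContDiffAt ℂ ω F ((u₀, A₀), D u₀ A₀) := contDiffAt_fixEq hCa hHa hu₀ A₀ (D u₀ A₀) hY₀R
  have hinr : (fderiv ℂ F ((u₀, A₀), D u₀ A₀) ∘L ContinuousLinearMap.inr ℂ (𝒰 × 𝒴) 𝒳).IsInvertible := by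
    rw [hF, fderiv_fixEq_comp_inr hCa hHa hu₀ A₀ (D u₀ A₀) hY₀R]
    exact (isInvertible_partial hCa hquad hHB hC₂ hB₀ hq hRC hDball hDfix hu₀ hA₀).1
  -- identification of Mathlib's implicit function with `D` near `(u₀, A₀)`
  have hcont : ContinuousAt (fun p : 𝒰 × 𝒴 => D p.1 p.2) (u₀, A₀) :=
    continuousAt_D h𝒪 hCa hquad hHa hHB hC₂ hB₀ hq hRC hDball hDfix hu₀ hA₀
  have heq : hFω.implicitFunction hω hinr =ᶠ[𝓝 (u₀, A₀)] fun p : 𝒰 × 𝒴 => D p.1 p.2 := by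
    have hψ := hFω.eventually_apply_eq_iff_implicitFunction hω hinr
    have ht : ContinuousAt (fun p : 𝒰 × 𝒴 => (p, D p.1 p.2)) (u₀, A₀) := continuousAt_id.prodMk hcont
    have h1 : ∀ᶠ p : 𝒰 × 𝒴 in 𝓝 (u₀, A₀), F (p, D p.1 p.2) = F ((u₀, A₀), D u₀ A₀) ↔
        hFω.implicitFunction hω hinr (p, D p.1 p.2).1 = (p, D p.1 p.2).2 := Filter.Tendsto.eventually ht hψ
    have hnbhd : ∀ᶠ p : 𝒰 × 𝒴 in 𝓝 (u₀, A₀), p.1 ∈ 𝒪 ∧ ‖p.2‖ < ε := by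
      have ho : IsOpen (𝒪 ×ˢ ball (0 : 𝒴) ε) := h𝒪.prod isOpen_ball
      filter_upwards [ho.mem_nhds (show (u₀, A₀) ∈ 𝒪 ×ˢ ball (0 : 𝒴) ε from ⟨hu₀, mem_ball_zero_iff.mpr hA₀⟩)]
        with p hp using ⟨hp.1, mem_ball_zero_iff.mp hp.2⟩
    filter_upwards [h1, hnbhd] with p h hp
    refine h.1 ?_
    show D p.1 p.2 - C p.1 (p.2 - H p.1 (D p.1 p.2)) = D u₀ A₀ - C u₀ (A₀ - H u₀ (D u₀ A₀))
    rw [hDfix p.1 hp.1 p.2 hp.2, hDfix u₀ hu₀ A₀ hA₀, sub_self, sub_self]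
  exact ((hFω.contDiffAt_implicitFunction hω hinr).analyticAt).congr heq

/-- **`D` is analytic on a neighbourhood of every point of `𝒪 ×ˢ {‖A′‖ < ε}`** (jointly in the background and the field).
[cite: Balaban1985Variational, p.287] -/
theorem analyticOnNhd_D (h𝒪 : IsOpen 𝒪) (hCa : AnalyticOnNhd ℂ (fun p : 𝒰 × 𝒴 => C p.1 p.2) (𝒪 ×ˢ {Y : 𝒴 | ‖Y‖ < R}))
    (hquad : ∀ u ∈ 𝒪, ∀ Y : 𝒴, ‖Y‖ < R → ‖C u Y‖ ≤ C₂ * ‖Y‖ ^ 2) (hHa : AnalyticOnNhd ℂ H 𝒪)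
    (hHB : ∀ u ∈ 𝒪, ‖H u‖ ≤ B₀) (hC₂ : 0 ≤ C₂) (hB₀ : 0 ≤ B₀) (hq : 9 * C₂ * B₀ * ε < 1) (hRC : 3 * ε ≤ R)
    (hDball : ∀ u ∈ 𝒪, ∀ A : 𝒴, ‖A‖ < ε → D u A ∈ closedBall (0 : 𝒳) (4 * C₂ * ε ^ 2))
    (hDfix : ∀ u ∈ 𝒪, ∀ A : 𝒴, ‖A‖ < ε → C u (A - H u (D u A)) = D u A) :
    AnalyticOnNhd ℂ (fun p : 𝒰 × 𝒴 => D p.1 p.2) (𝒪 ×ˢ ball (0 : 𝒴) ε) := fun p hp =>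
  analyticAt_D (u₀ := p.1) (A₀ := p.2) h𝒪 hCa hquad hHa hHB hC₂ hB₀ hq hRC hDball hDfix hp.1 (mem_ball_zero_iff.mp hp.2)

/-- **«it is an analytic function of U₀»**: for each fixed field `A′` with `‖A′‖ < ε`, the background dependence `U₀ ↦ D(U₀, A′)` is analytic at
every `U₀ ∈ 𝒪`. [cite: Balaban1985Variational, p.287] -/
theorem analyticAt_D_background (h𝒪 : IsOpen 𝒪) (hCa : AnalyticOnNhd ℂ (fun p : 𝒰 × 𝒴 => C p.1 p.2) (𝒪 ×ˢ {Y : 𝒴 | ‖Y‖ < R}))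
    (hquad : ∀ u ∈ 𝒪, ∀ Y : 𝒴, ‖Y‖ < R → ‖C u Y‖ ≤ C₂ * ‖Y‖ ^ 2) (hHa : AnalyticOnNhd ℂ H 𝒪)
    (hHB : ∀ u ∈ 𝒪, ‖H u‖ ≤ B₀) (hC₂ : 0 ≤ C₂) (hB₀ : 0 ≤ B₀) (hq : 9 * C₂ * B₀ * ε < 1) (hRC : 3 * ε ≤ R)
    (hDball : ∀ u ∈ 𝒪, ∀ A : 𝒴, ‖A‖ < ε → D u A ∈ closedBall (0 : 𝒳) (4 * C₂ * ε ^ 2))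
    (hDfix : ∀ u ∈ 𝒪, ∀ A : 𝒴, ‖A‖ < ε → C u (A - H u (D u A)) = D u A)
    {u₀ : 𝒰} (hu₀ : u₀ ∈ 𝒪) {A₀ : 𝒴} (hA₀ : ‖A₀‖ < ε) :
    AnalyticAt ℂ (fun u : 𝒰 => D u A₀) u₀ := by
  have hj := analyticAt_D h𝒪 hCa hquad hHa hHB hC₂ hB₀ hq hRC hDball hDfix hu₀ hA₀
  have h2 : AnalyticAt ℂ (fun u : 𝒰 => (u, A₀)) u₀ := analyticAt_id.prod analyticAt_const
  have h3 := AnalyticAt.comp_of_eq hj h2 rfl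
  simpa [Function.comp_def] using h3

/-- **«D(A′) has the same analyticity domain as H(U₀)»**: for each fixed `A′`, `U₀ ↦ D(U₀, A′)` is analytic on the WHOLE parameter domain
`𝒪` of the data. [cite: Balaban1985Variational, p.287] -/
theorem analyticOnNhd_D_background (h𝒪 : IsOpen 𝒪)
    (hCa : AnalyticOnNhd ℂ (fun p : 𝒰 × 𝒴 => C p.1 p.2) (𝒪 ×ˢ {Y : 𝒴 | ‖Y‖ < R}))
    (hquad : ∀ u ∈ 𝒪, ∀ Y : 𝒴, ‖Y‖ < R → ‖C u Y‖ ≤ C₂ * ‖Y‖ ^ 2) (hHa : AnalyticOnNhd ℂ H 𝒪)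
    (hHB : ∀ u ∈ 𝒪, ‖H u‖ ≤ B₀) (hC₂ : 0 ≤ C₂) (hB₀ : 0 ≤ B₀) (hq : 9 * C₂ * B₀ * ε < 1) (hRC : 3 * ε ≤ R)
    (hDball : ∀ u ∈ 𝒪, ∀ A : 𝒴, ‖A‖ < ε → D u A ∈ closedBall (0 : 𝒳) (4 * C₂ * ε ^ 2))
    (hDfix : ∀ u ∈ 𝒪, ∀ A : 𝒴, ‖A‖ < ε → C u (A - H u (D u A)) = D u A) {A₀ : 𝒴} (hA₀ : ‖A₀‖ < ε) :
    AnalyticOnNhd ℂ (fun u : 𝒰 => D u A₀) 𝒪 := fun _ hu =>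
  analyticAt_D_background h𝒪 hCa hquad hHa hHB hC₂ hB₀ hq hRC hDball hDfix hu hA₀

/-- **«an analytic function of A′ … satisfying |A′|₍₋₁₎ < ε₃»** recovered per background from the joint statement (cf.
`B12LinearizAnalytic267.analyticOnNhd_Dt`). [cite: Balaban1985Variational, p.287] -/
theorem analyticOnNhd_D_field (h𝒪 : IsOpen 𝒪) (hCa : AnalyticOnNhd ℂ (fun p : 𝒰 × 𝒴 => C p.1 p.2) (𝒪 ×ˢ {Y : 𝒴 | ‖Y‖ < R}))
    (hquad : ∀ u ∈ 𝒪, ∀ Y : 𝒴, ‖Y‖ < R → ‖C u Y‖ ≤ C₂ * ‖Y‖ ^ 2) (hHa : AnalyticOnNhd ℂ H 𝒪)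
    (hHB : ∀ u ∈ 𝒪, ‖H u‖ ≤ B₀) (hC₂ : 0 ≤ C₂) (hB₀ : 0 ≤ B₀) (hq : 9 * C₂ * B₀ * ε < 1) (hRC : 3 * ε ≤ R)
    (hDball : ∀ u ∈ 𝒪, ∀ A : 𝒴, ‖A‖ < ε → D u A ∈ closedBall (0 : 𝒳) (4 * C₂ * ε ^ 2))
    (hDfix : ∀ u ∈ 𝒪, ∀ A : 𝒴, ‖A‖ < ε → C u (A - H u (D u A)) = D u A) {u₀ : 𝒰} (hu₀ : u₀ ∈ 𝒪) :
    AnalyticOnNhd ℂ (D u₀) (ball (0 : 𝒴) ε) := fun A hA => by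
  have hj := analyticAt_D h𝒪 hCa hquad hHa hHB hC₂ hB₀ hq hRC hDball hDfix hu₀ (mem_ball_zero_iff.mp hA)
  have h2 : AnalyticAt ℂ (fun A' : 𝒴 => (u₀, A')) A := analyticAt_const.prod analyticAt_id
  have h3 := AnalyticAt.comp_of_eq hj h2 rfl
  simpa [Function.comp_def] using h3

/-- **The printed shape with two domains** — *«the averaging operations Q_j(U₀, ηA) and the operator H(U₀) are analytic in U₀. The analyticity
domain is smaller for H(U₀) … so D(A′) has the same analyticity domain as H(U₀)»*: if `C` is jointly analytic over a domain `𝒪_Q` and `H`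
analytic over an open `𝒪_H ⊆ 𝒪_Q` (with the constants on `𝒪_H`), then `U₀ ↦ D(U₀, A′)` is analytic on `𝒪_H`. [cite: Balaban1985Variational, p.287] -/
theorem analyticOnNhd_D_background_of_subdomain {𝒪Q 𝒪H : Set 𝒰} (hopen : IsOpen 𝒪H) (hsub : 𝒪H ⊆ 𝒪Q)
    (hCa : AnalyticOnNhd ℂ (fun p : 𝒰 × 𝒴 => C p.1 p.2) (𝒪Q ×ˢ {Y : 𝒴 | ‖Y‖ < R}))
    (hquad : ∀ u ∈ 𝒪H, ∀ Y : 𝒴, ‖Y‖ < R → ‖C u Y‖ ≤ C₂ * ‖Y‖ ^ 2) (hHa : AnalyticOnNhd ℂ H 𝒪H)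
    (hHB : ∀ u ∈ 𝒪H, ‖H u‖ ≤ B₀) (hC₂ : 0 ≤ C₂) (hB₀ : 0 ≤ B₀) (hq : 9 * C₂ * B₀ * ε < 1) (hRC : 3 * ε ≤ R)
    (hDball : ∀ u ∈ 𝒪H, ∀ A : 𝒴, ‖A‖ < ε → D u A ∈ closedBall (0 : 𝒳) (4 * C₂ * ε ^ 2))
    (hDfix : ∀ u ∈ 𝒪H, ∀ A : 𝒴, ‖A‖ < ε → C u (A - H u (D u A)) = D u A) {A₀ : 𝒴} (hA₀ : ‖A₀‖ < ε) :
    AnalyticOnNhd ℂ (fun u : 𝒰 => D u A₀) 𝒪H :=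
  analyticOnNhd_D_background hopen (hCa.mono (prod_mono hsub le_rfl)) hquad hHa hHB hC₂ hB₀ hq hRC hDball hDfix hA₀

end Literature.MathematicalPhysics.QuantumFieldTheory.Balaban1983to89.B11Rem287U0Analytic
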